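import Summits.Ventures.CertifiedManyBodySolver.Observables.PairLROOnePointTwisted
import Literature.MathematicalPhysics.QuantumLattice.TwistedFlipSpaceGroupUnitary
import HarnessLib

/-!
# Ventures/CertifiedManyBodySolver — Observables/PairLROOnePointTwistedFlip.lean

HONEST FRAMING: first certified bounds on pairing observables; a one-point CEILING route — a ceiling never
speaks to the presence of pairing; not a superconductivity verdict; nothing in this file is a number.

Cell `hubbard-obs` (D-0042), seat p1, `prover-hubbard-obs-p1-g7-0`. W8 «TwistedOrbitFamily», SPIN-FLIP leg:
the reading and the registry consumer for one-point nodes certified under eng-2's FULL twisted identification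
«translations × D₄ × flip» (`TwistedFlipSpaceGroupUnitary`: the `b₁g`-odd lattice elements AND the spin exchange
composed with the gauge quarter turn; ×3.8 fewer variables than the `D₂` export, no transplant).

* `re_orbitState_twistedFlipSpaceGroupUnitary_localPairAt` — for EVERY nonempty `S ⊆ D₄` the flip-twisted
  orbit state of `ζ` evaluates the pulled-back local `d`-wave pair at the origin to `Re⟨ζ, Δ_d ζ⟩/L²`
  (three signs cancel: `b1gSign γ`, `(−1)^f` from the singlet being flip-odd, `(−1)^{j(γ)+f}` from the twist);
* `ObsPairLROCeilingAt_of_onePoint_twistedFlip_orbitState_bound_sq` (+ `_reprice`) — the consumer at any anchor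
  `(U, n, t′)`. NODE SHAPE: as the OP1-E node but (i) `orbitState (twistedFlipSpaceGroupUnitary S)`, (ii) ONE
  flip-symmetric filling row `μ₀ (Re⟨ζ, N̂ ζ⟩/L² − ν₀)` on the TOTAL number (the flip exchanges `N_↑, N_↓`;
  the twisted builds use a single filling multiplier anyway); leaf at every `c' ≥ (c − A + μ₀(n − ν₀))²`.

No named fact, zero computation, no `sorry`; CONDITIONAL on the claim node fed in.
References: T. Koma, H. Tasaki, J. Stat. Phys. 76 (1994) 745, Theorem 5 [KomaTasaki1994]; G. Benfatto,
A. Giuliani, V. Mastropietro, Ann. Henri Poincaré 7 (2006) 809, §2.1 [BenfattoGiulianiMastropietro2006];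
D. J. Scalapino, Phys. Rep. 250 (1995) 329, §2 eq. (2.3) [Scalapino1995].
-/

noncomputable section

namespace Summit.Ventures.CertifiedManyBodySolver.Observables

open Matrix Complex Literature.MathematicalPhysics.QuantumLattice Literature.Probability.LatticeModels
open Literature.MathematicalPhysics.QuantumLattice.HubbardWave0 ThermodynamicLimit Filter Topology
open Literature.MathematicalPhysics.QuantumManyBody.StateRelaxation
open Summit.Ventures.CertifiedManyBodySolver.Transport
open scoped ComplexOrder ComplexConjugate BigOperators

section Torus

variable {L : ℕ} [NeZero L]

/-- (Local to this section: the same `DecidableEq (FermionTorus 2 L)` shim under which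
`TwistedFlipSpaceGroupUnitary` states its matrix powers `F^f`.) [folklore] -/
local instance (priority := high) instDecidableEqFermionTorusTwFlipObs : DecidableEq (FermionTorus 2 L) :=
  LinearOrder.toDecidableEq

/-- `⟨Mᴴ φ, A Mᴴ φ⟩ = ⟨φ, M A Mᴴ φ⟩`. [folklore] -/
private theorem expect_conjTranspose_mulVec₃ {ι : Type*} [LinearOrder ι] [Fintype ι]
    (A M : Matrix (Finset ι) (Finset ι) ℂ) (φ : Fock ι) :
    expect A (Mᴴ *ᵥ φ) = expect (M * A * Mᴴ) φ := by
  unfold expect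
  rw [star_mulVec, conjTranspose_conjTranspose, ← dotProduct_mulVec, mulVec_mulVec, mulVec_mulVec]

/-- The sign bookkeeping of the flip twist: `(−1)^{j(γ)+f+2m} · (−1)^f · b1gSign γ = 1`. [cite: Scalapino1995, §2 eq. (2.3)] -/
theorem neg_one_pow_twistFlipExp_mul (γ : DihedralGroup 4) (f m : Fin 2) :
    ((-1 : ℂ) ^ twistFlipExp γ f m) * ((-1 : ℂ) ^ f.val) * ((b1gSign γ : ℝ) : ℂ) = 1 := by
  rw [b1gSign_eq_neg_one_pow_b1gTwist, twistFlipExp, pow_add, pow_add, pow_mul]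
  push_cast
  rw [neg_one_sq, one_pow, mul_one,
    show ((-1 : ℂ) ^ b1gTwist γ * (-1) ^ f.val * (-1) ^ f.val * (-1) ^ b1gTwist γ) =
      ((-1 : ℂ) ^ b1gTwist γ * (-1) ^ b1gTwist γ) * ((-1) ^ f.val * (-1) ^ f.val) by ring,
    ← pow_add, ← pow_add, ← two_mul, ← two_mul, pow_mul, pow_mul, neg_one_sq, one_pow, one_pow, one_mul]

/-- **The flip-twisted orbit state reads the `d`-wave one-point amplitude for EVERY point group `S ⊆ D₄`.**
[cite: KomaTasaki1994, Theorem 5] [cite: Scalapino1995, §2 eq. (2.3)] -/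
theorem re_orbitState_twistedFlipSpaceGroupUnitary_localPairAt {S : Finset (DihedralGroup 4)} (hS : S.Nonempty)
    {Λ' : Finset (Site 2)} (h0 : pairRegion (insert (0 : Site 2) unitSteps) 0 ⊆ Λ')
    (hInj' : Set.InjOn (Torus.proj (d := 2) L) ↑Λ') (ζ : Fock (Orb (FermionTorus 2 L))) :
    (orbitState (twistedFlipSpaceGroupUnitary S) ζ (fermionEmbed (PolySite.toTorusEmb L hInj')
        (fermionEmbed (PolySite.incl h0) (localPairAt (insert (0 : Site 2) unitSteps) dWaveFormFactor 0)))).re =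
      (expect (pairField dWaveFormFactor L) ζ).re / (L : ℝ) ^ 2 := by
  haveI : Nonempty ↥S := ⟨⟨hS.choose, hS.choose_spec⟩⟩
  have hInj0 : Set.InjOn (Torus.proj (d := 2) L) ↑(pairRegion (insert (0 : Site 2) unitSteps) 0) :=
    hInj'.mono (by exact_mod_cast h0)
  have hproj0 : Torus.proj L (0 : Site 2) = (0 : TorusSite 2 L) := by funext i; simp [Torus.proj]
  have hP0 : fermionEmbed (PolySite.toTorusEmb L hInj')
      (fermionEmbed (PolySite.incl h0) (localPairAt (insert (0 : Site 2) unitSteps) dWaveFormFactor 0)) =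
      localPair dWaveFormFactor L 0 := by
    rw [fermionEmbed_toTorusEmb_incl h0 hInj', fermionEmbed_toTorusEmb_localPairAt L _ dWaveFormFactor 0 hInj0,
      hproj0, localPairOn_insert_zero_unitSteps]
  have hterm : ∀ gm : ((TorusSite 2 L × ↥S) × Fin 2) × Fin 2,
      Literature.MathematicalPhysics.QuantumManyBody.StateRelaxation.vectorState
          ((twistedFlipSpaceGroupUnitary S gm)ᴴ *ᵥ ζ) (localPair dWaveFormFactor L 0) =
        expect (localPair dWaveFormFactor L (d4Site (gm.1.1.2 : DihedralGroup 4) 0 + gm.1.1.1)) ζ := by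
    rintro ⟨⟨⟨v, γ, hγ⟩, f⟩, m⟩
    rw [Literature.MathematicalPhysics.QuantumManyBody.StateRelaxation.vectorState_apply,
      show star ((twistedFlipSpaceGroupUnitary S (((v, ⟨γ, hγ⟩), f), m))ᴴ *ᵥ ζ) ⬝ᵥ
        localPair dWaveFormFactor L 0 *ᵥ ((twistedFlipSpaceGroupUnitary S (((v, ⟨γ, hγ⟩), f), m))ᴴ *ᵥ ζ) =
        expect (localPair dWaveFormFactor L 0) ((twistedFlipSpaceGroupUnitary S (((v, ⟨γ, hγ⟩), f), m))ᴴ *ᵥ ζ) from rfl,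
      expect_conjTranspose_mulVec₃, twistedFlipSpaceGroupUnitary_apply]
    have hconj : spaceGroupUnitary S (v, ⟨γ, hγ⟩) * fockSpinFlip ^ f.val * fockGauge (twistFlipExp γ f m) *
          localPair dWaveFormFactor L 0 *
        (spaceGroupUnitary S (v, ⟨γ, hγ⟩) * fockSpinFlip ^ f.val * fockGauge (twistFlipExp γ f m))ᴴ =
        localPair dWaveFormFactor L (d4Site γ 0 + v) := by
      rw [conjTranspose_mul, conjTranspose_mul,
        show spaceGroupUnitary S (v, ⟨γ, hγ⟩) * fockSpinFlip ^ f.val * fockGauge (twistFlipExp γ f m) *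
            localPair dWaveFormFactor L 0 *
            ((fockGauge (twistFlipExp γ f m))ᴴ * ((fockSpinFlip ^ f.val)ᴴ * (spaceGroupUnitary S (v, ⟨γ, hγ⟩))ᴴ)) =
          spaceGroupUnitary S (v, ⟨γ, hγ⟩) * (fockSpinFlip ^ f.val *
            (fockGauge (twistFlipExp γ f m) * localPair dWaveFormFactor L 0 * (fockGauge (twistFlipExp γ f m))ᴴ) *
            (fockSpinFlip ^ f.val)ᴴ) * (spaceGroupUnitary S (v, ⟨γ, hγ⟩))ᴴ by simp only [Matrix.mul_assoc],
        fockGauge_conj_localPair, Matrix.mul_smul, Matrix.smul_mul, fockSpinFlip_pow_conj_localPair, smul_smul,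
        Matrix.mul_smul, Matrix.smul_mul,
        show spaceGroupUnitary S (v, ⟨γ, hγ⟩) * localPair dWaveFormFactor L 0 * (spaceGroupUnitary S (v, ⟨γ, hγ⟩))ᴴ =
          (fockTranslate v).val * (fockD4 (L := L) γ).val * localPair dWaveFormFactor L 0 *
            ((fockTranslate v).val * (fockD4 (L := L) γ).val)ᴴ from rfl,
        d4Affine_conj, relabel_d4Perm_localPair_of_parity γ dWaveFormFactor (b1gSign γ) (b1gSign_mul_self γ)
          (dWaveFormFactor_d4Vec_eq_b1gSign_mul γ),
        relabel_smul, relabel_translate_localPair, smul_smul, neg_one_pow_twistFlipExp_mul, one_smul]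
    simp only at hconj ⊢
    rw [hconj]
  rw [hP0, orbitState_apply, Fintype.sum_congr _ _ hterm, Fintype.sum_prod_type, Fintype.sum_prod_type,
    Fintype.sum_prod_type]
  simp only [Finset.sum_const, Finset.card_univ, Fintype.card_fin, nsmul_eq_mul]
  have hinner : ∀ γ' : ↥S, ∑ v : TorusSite 2 L,
      expect (localPair dWaveFormFactor L (d4Site (γ' : DihedralGroup 4) 0 + v)) ζ =
        expect (pairField dWaveFormFactor L) ζ := by
    intro γ'
    rw [pairField, expect_sum]
    exact Fintype.sum_equiv (Equiv.addLeft (d4Site (γ' : DihedralGroup 4) 0)) _ _ fun v => rfl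
  rw [Finset.sum_comm]
  simp_rw [← Finset.mul_sum, hinner, Finset.sum_const, Finset.card_univ, nsmul_eq_mul]
  rw [Fintype.card_prod, Fintype.card_prod, Fintype.card_prod, Literature.Probability.LatticeModels.card_torusSite,
    Fintype.card_coe, Fintype.card_fin]
  have hS0 : (S.card : ℂ) ≠ 0 := Nat.cast_ne_zero.2 (Finset.card_pos.2 hS).ne'
  have hL2 : ((L : ℂ)) ^ 2 ≠ 0 := pow_ne_zero 2 (Nat.cast_ne_zero.2 (NeZero.ne L))
  have key : (((L ^ 2 * S.card * 2 * 2 : ℕ) : ℂ))⁻¹ *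
      (((2 : ℕ) : ℂ) * (((2 : ℕ) : ℂ) * ((S.card : ℂ) * expect (pairField dWaveFormFactor L) ζ))) =
      expect (pairField dWaveFormFactor L) ζ / ((((L : ℝ) ^ 2 : ℝ)) : ℂ) := by
    push_cast
    field_simp
  rw [key, Complex.div_ofReal_re]

end Torus

/-! ### The registry consumer for FLIP-TWISTED one-point nodes, any anchor -/

section Consumer

variable {tp U n : ℝ} {hi c' : ℚ} {c A κ u μ₀ ν₀ : ℝ}

/-- Flip-symmetric filling: `Σ_σ μ₀ (Re⟨ζ, N_σ ζ⟩/L² − ν₀/2) = μ₀ (Re⟨ζ, N̂ ζ⟩/L² − ν₀)`. [cite: KomaTasaki1994, Theorem 5] -/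
theorem sum_spin_filling_eq_total {L : ℕ} (ζ : Fock (Orb (FermionTorus 2 L))) (μ₀ ν₀ : ℝ) :
    ∑ σ : Fin 2, μ₀ * ((star ζ ⬝ᵥ ((∑ y : FermionTorus 2 L, numberOp y σ) *ᵥ ζ)).re / (L : ℝ) ^ 2 - ν₀ / 2) =
      μ₀ * ((star ζ ⬝ᵥ ((totalNumber : Matrix (Finset (Orb (FermionTorus 2 L))) _ ℂ) *ᵥ ζ)).re / (L : ℝ) ^ 2 - ν₀) := by
  have hN : (totalNumber : Matrix (Finset (Orb (FermionTorus 2 L))) _ ℂ) =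
      (∑ y : FermionTorus 2 L, numberOp y 0) + ∑ y : FermionTorus 2 L, numberOp y 1 := by
    rw [totalNumber, ← Finset.sum_add_distrib]
    exact Finset.sum_congr rfl fun y _ => Fin.sum_univ_two _
  rw [Fin.sum_univ_two, hN, add_mulVec, dotProduct_add, Complex.add_re]
  ring

/-- **Flip-twisted OP1-E orbit-state node at `(U, n, t′)` ⇒ the leaf at the sharp (Koma–Tasaki tower) constant**
`M² = (c − A + μ₀(n − ν₀))²`: point group `S ≠ ∅` (no `b1gSign` hypothesis), window `Λ' ⊇ pairRegion {0,±e₁,±e₂} 0`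
fitting the tori of side `≥ L₁`, `κ ≥ 0`, cap `e₀(U, n, t′) ≤ hi ≤ u`, `0 ≤ U`, `0 ≤ n < 2`, ONE total-filling row
`μ₀ (Re⟨ζ, N̂ζ⟩/L² − ν₀)`. [cite: KomaTasaki1994, Theorem 5] -/
theorem ObsPairLROCeilingAt_of_onePoint_twistedFlip_orbitState_bound_sq (hU : 0 ≤ U) (hn0 : 0 ≤ n) (hn2 : n < 2)
    (hκ : 0 ≤ κ) (hE : energyDensityTT' 1 tp U n ≤ ((hi : ℚ) : ℝ)) (hhi : ((hi : ℚ) : ℝ) ≤ u)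
    {S : Finset (DihedralGroup 4)} (hS : S.Nonempty)
    {Λ' : Finset (Site 2)} (h0 : pairRegion (insert (0 : Site 2) unitSteps) 0 ⊆ Λ') (L₁ : ℕ)
    (hInj : ∀ L : ℕ, L₁ ≤ L → Set.InjOn (Torus.proj (d := 2) L) ↑Λ')
    (hbound : ∀ (L : ℕ) [NeZero L] (hL : L₁ ≤ L) (ζ : Fock (Orb (FermionTorus 2 L))), star ζ ⬝ᵥ ζ = 1 →
      c - A + μ₀ * ((star ζ ⬝ᵥ ((totalNumber : Matrix (Finset (Orb (FermionTorus 2 L))) _ ℂ) *ᵥ ζ)).re /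
          (L : ℝ) ^ 2 - ν₀) +
        κ * (u - (star ζ ⬝ᵥ (hubbardTorusTT' L 1 tp U *ᵥ ζ)).re / (L : ℝ) ^ 2) ≤
        (orbitState (twistedFlipSpaceGroupUnitary S) ζ (fermionEmbed (PolySite.toTorusEmb L (hInj L hL))
          (-(fermionEmbed (PolySite.incl h0)
            (localPairAt (insert (0 : Site 2) unitSteps) dWaveFormFactor 0))))).re)
    (hc' : (c - A + μ₀ * (n - ν₀)) ^ 2 ≤ ((c' : ℚ) : ℝ)) :
    ObsPairLROCeilingAt tp U n c' := by
  intro ψ hψ hψ1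
  have hc'' : (c - A + (∑ _σ : Fin 2, μ₀) * (n / 2 - ν₀ / 2)) ^ 2 ≤ ((c' : ℚ) : ℝ) := by
    rw [Fin.sum_univ_two, show (μ₀ + μ₀) * (n / 2 - ν₀ / 2) = μ₀ * (n - ν₀) by ring]
    exact hc'
  refine (liminf_pairFieldLRO_le_sq_of_onePoint_variational_bound_TT' dWaveFormFactor 1 tp hU hn0 hn2
    (fun _ => μ₀) hκ (hE.trans hhi) L₁ ?_ ψ hψ hψ1).trans hc''
  intro L _ hL ζ hζ
  have h := hbound L hL ζ hζ
  rw [fermionEmbed_neg, map_neg, Complex.neg_re,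
    re_orbitState_twistedFlipSpaceGroupUnitary_localPairAt hS h0 (hInj L hL) ζ, ← sum_spin_filling_eq_total ζ μ₀ ν₀] at h
  exact h

/-- **THE ONE-POINT FAST LAYER for flip-twisted nodes**: the same node read under ANY certified cap `e₀ ≤ hi` gives
the leaf at every `c' ≥ (c − A + μ₀(n − ν₀) + κ(u − hi))²`. [cite: KomaTasaki1994, Theorem 5] -/
theorem ObsPairLROCeilingAt_of_onePoint_twistedFlip_orbitState_bound_sq_reprice (hU : 0 ≤ U) (hn0 : 0 ≤ n)
    (hn2 : n < 2) (hκ : 0 ≤ κ) (hE : energyDensityTT' 1 tp U n ≤ ((hi : ℚ) : ℝ))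
    {S : Finset (DihedralGroup 4)} (hS : S.Nonempty)
    {Λ' : Finset (Site 2)} (h0 : pairRegion (insert (0 : Site 2) unitSteps) 0 ⊆ Λ') (L₁ : ℕ)
    (hInj : ∀ L : ℕ, L₁ ≤ L → Set.InjOn (Torus.proj (d := 2) L) ↑Λ')
    (hbound : ∀ (L : ℕ) [NeZero L] (hL : L₁ ≤ L) (ζ : Fock (Orb (FermionTorus 2 L))), star ζ ⬝ᵥ ζ = 1 →
      c - A + μ₀ * ((star ζ ⬝ᵥ ((totalNumber : Matrix (Finset (Orb (FermionTorus 2 L))) _ ℂ) *ᵥ ζ)).re /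
          (L : ℝ) ^ 2 - ν₀) +
        κ * (u - (star ζ ⬝ᵥ (hubbardTorusTT' L 1 tp U *ᵥ ζ)).re / (L : ℝ) ^ 2) ≤
        (orbitState (twistedFlipSpaceGroupUnitary S) ζ (fermionEmbed (PolySite.toTorusEmb L (hInj L hL))
          (-(fermionEmbed (PolySite.incl h0)
            (localPairAt (insert (0 : Site 2) unitSteps) dWaveFormFactor 0))))).re)
    (hc' : (c - A + μ₀ * (n - ν₀) + κ * (u - ((hi : ℚ) : ℝ))) ^ 2 ≤ ((c' : ℚ) : ℝ)) :
    ObsPairLROCeilingAt tp U n c' := by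
  have hc'' : (c + κ * (u - ((hi : ℚ) : ℝ)) - A + μ₀ * (n - ν₀)) ^ 2 ≤ ((c' : ℚ) : ℝ) := by
    have : c + κ * (u - ((hi : ℚ) : ℝ)) - A + μ₀ * (n - ν₀) = c - A + μ₀ * (n - ν₀) + κ * (u - ((hi : ℚ) : ℝ)) := by
      ring
    rw [this]; exact hc'
  refine ObsPairLROCeilingAt_of_onePoint_twistedFlip_orbitState_bound_sq (c := c + κ * (u - ((hi : ℚ) : ℝ)))
    (u := ((hi : ℚ) : ℝ)) hU hn0 hn2 hκ hE le_rfl hS h0 L₁ hInj ?_ hc''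
  intro L _ hL ζ hζ
  convert hbound L hL ζ hζ using 1
  ring

end Consumer

end Summit.Ventures.CertifiedManyBodySolver.Observables

end
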